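import Literature.Analysis.FluidPDE.LeiZhang2011SliceEstimates
import Literature.Analysis.FluidPDE.LeiZhang2011Cutoff
import Literature.Analysis.FunctionSpaces.PoincareWeighted
import Literature.Analysis.FluidPDE.LeiZhang2011AxisSlice
import Literature.Analysis.FluidPDE.NashLogIntegralInequality
import HarnessLib

/-!
# Lei–Zhang 2011, Lemma 3.2: the slice estimates for the logarithm `Ψ = −ln Φ`

Analysis/FluidPDE proofs file (theorems only), on the discharge path of the named fact
`Literature.Analysis.FluidPDE.LeiZhang2011_liouville` (Z. Lei, Q. S. Zhang, J. Funct. Anal. 261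
(2011) = arXiv:1011.5066, Theorem 1.2). In the proof of Lemma 3.2 (arXiv p. 9) the equation for
`Ψ = −ln Φ̃`, `∂ₜΨ + b·∇Ψ + (2/r)∂ᵣΨ − ΔΨ + |∇Ψ|² = 0`, is tested against `ζ²`; the cut-off
terms are absorbed into the good term `∫ |∇Ψ|² ζ²` by Cauchy–Schwarz. In the tree's
`H`-calculus (`energy_identity_axis` with `H = −log`, so that `H'' = H'²` and the good term is
`∫ H'(F)² ‖∇F‖² φ² = ∫ ‖∇Ψ‖² φ²`) these are the following two slice estimates, valid for an
arbitrary `H ∈ C²` (no sign or convexity condition; Young's inequality with the weight `H'²`):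

* `abs_integral_deriv_comp_inner_gradient_le_sq` — the viscous cut-off term:
  `|∫ H'(F)⟪∇F, ∇φ²⟫| ≤ ε ∫ H'(F)²‖∇F‖²φ² + ε⁻¹ ∫ ‖∇φ‖²`
  ("`≤ ¼∫|∇Ψ|²ζ² + ∫|∇ζ|²`", p. 9);
* `abs_integral_comp_inner_gradient_le_sq` — the transport term through the stream function
  `b = curl B` (`∫ H(F)⟪b, ∇φ²⟫ = ∫ ⟪B − c, ∇(H∘F) × ∇φ²⟫`):
  `|∫ H(F)⟪b, ∇φ²⟫| ≤ ε ∫ H'(F)²‖∇F‖²φ² + ε⁻¹ ∫ ‖B − c‖²‖∇φ‖²`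
  ("`|∫ζ²b₂·∇(Ψ − Ψ̄)| = |∫∇ζ² ∇×B (Ψ − Ψ̄)| ≲ … ≲ ⅛∫|∇Ψ|²ζ² + C‖B‖²_BMO`", p. 9, before the
  John–Nirenberg step);

and the remaining slice ingredients of the proof of Lemma 3.2 for the concrete cut-off
`φ = radialCutoff (ρ/2) ρ` (the paper's `ζ_R`, up to the normalisation `Z = ∫φ²`):

* `integral_sub_average_sq_mul_radialCutoff_sq_le` — the weighted Poincaré inequality (3.4),
  `∫ |Ψ − Ψ̄|² φ² ≤ 256 ρ² ∫ ‖∇Ψ‖² φ²` (from Moser's lemma `PoincareWeighted`);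
* `radialCutoff_sq_mass`, `radialCutoff_sq_axis_mass`, `integral_axis_weight_radialCutoff_sq` —
  `Z ∈ [(ρ/2)³|B₁|, ρ³|B₁|]`, `∫ φ(0,0,z)² dz ∈ [ρ, 2ρ]`, `∫ (2/r)∂ᵣ(φ²) = −2c₂∫φ(0,0,z)²dz`;
* `integral_axis_term_log_le` — the axis term: `∫(2/r)Ψ∂ᵣφ² ≤ δ∫‖∇Ψ‖²φ² + C(δ)ρ − (A/Z)∫Ψφ²`
  ("`≤ C − CΨ̄(s) + ⅛∫|∇Ψ|²ζ²`", p. 9);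
* `nash_poincare_lower` — Nash's inequality (Lemma 3.1) with the weighted Poincaré inequality on
  the slices of the set `W` (p. 10): `w₀² Y²/(9216 ρ² Z) ≤ ∫ H'(F)²‖∇F‖²φ²` when
  `∫Fφ² ≥ w₀Z` and `Y = ∫H(F)φ² ≥ 2L₀Z`.

## References

* Z. Lei, Q. S. Zhang, J. Funct. Anal. 261 (2011) = arXiv:1011.5066, Lemma 3.1 and the proof of
  Lemma 3.2, pp. 9–10. [LeiZhang2011]
* G. M. Lieberman, *Second Order Parabolic Differential Equations* (1996), Lemma 6.12 (Moser's
  weighted Poincaré inequality). [Lieberman1996]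
-/

noncomputable section

open MeasureTheory Set Function Filter Metric
open _root_.Topology
open scoped InnerProductSpace RealInnerProductSpace NNReal ENNReal

namespace Literature.Analysis.FluidPDE

namespace LeiZhang2011

/-- **The viscous cut-off term for the logarithm** (Lei–Zhang 2011, proof of Lemma 3.2, p. 9:
"`≤ ¼∫|∇Ψ|²ζ² + ∫|∇ζ|²`"): for `F ∈ C¹`, any `H ∈ C²`, a cut-off `φ ∈ C¹_c` and `ε > 0`,
`|∫ H'(F)⟪∇F, ∇(φ²)⟫| ≤ ε ∫ H'(F)²‖∇F‖²φ² + ε⁻¹ ∫ ‖∇φ‖²` (pointwise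
`2|H'(F)|‖∇F‖|φ|‖∇φ‖ ≤ ε H'(F)²‖∇F‖²φ² + ε⁻¹‖∇φ‖²`). [cite: LeiZhang2011, proof of Lemma 3.2 (arXiv p. 9), the term ∫|∇ζ|²] -/
theorem abs_integral_deriv_comp_inner_gradient_le_sq {F : EuclideanSpace ℝ (Fin 3) → ℝ}
    (hF : ContDiff ℝ 1 F) {H : ℝ → ℝ} (hH : ContDiff ℝ 2 H)
    {φ : EuclideanSpace ℝ (Fin 3) → ℝ} (hφ : ContDiff ℝ 1 φ) (hφc : HasCompactSupport φ)
    {ε : ℝ} (hε : 0 < ε) :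
    |∫ x, deriv H (F x) * ⟪gradient F x, gradient (fun y => φ y ^ 2) x⟫| ≤
      ε * (∫ x, deriv H (F x) ^ 2 * ‖gradient F x‖ ^ 2 * φ x ^ 2) +
        ε⁻¹ * ∫ x, ‖gradient φ x‖ ^ 2 := by
  have hH' : Continuous (deriv H) := hH.continuous_deriv (by norm_num)
  -- `∇(φ²) = 2φ ∇φ`
  have hgrad2 : ∀ x, gradient (fun y => φ y ^ 2) x = (2 * φ x) • gradient φ x := by
    intro x
    have hd : DifferentiableAt ℝ φ x := (hφ.differentiable one_ne_zero) x
    have h := gradient_comp_apply (H := fun t : ℝ => t ^ 2) (F := φ)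
      ((differentiable_pow 2) (φ x)) hd
    simp only [deriv_pow_field, Nat.cast_ofNat, Nat.add_one_sub_one, pow_one] at h
    exact h
  -- pointwise Young with `h₀ = 1`, `h₂ = h₁²`, `κ = 1`
  have hpt : ∀ x, |deriv H (F x) * ⟪gradient F x, gradient (fun y => φ y ^ 2) x⟫| ≤
      ε * (deriv H (F x) ^ 2 * ‖gradient F x‖ ^ 2 * φ x ^ 2) + ε⁻¹ * ‖gradient φ x‖ ^ 2 := by
    intro x
    rw [hgrad2 x, inner_smul_right, abs_mul, abs_mul]
    have hCS : |⟪gradient F x, gradient φ x⟫| ≤ ‖gradient F x‖ * ‖gradient φ x‖ :=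
      abs_real_inner_le_norm _ _
    have hY := two_mul_abs_mul_mul_le (h₀ := 1) (h₁ := deriv H (F x)) (h₂ := deriv H (F x) ^ 2)
      (κ := 1) (‖gradient F x‖ * |φ x|) ‖gradient φ x‖ hε zero_le_one zero_le_one (sq_nonneg _)
      (by rw [mul_one, one_mul])
    calc |deriv H (F x)| * (|2 * φ x| * |⟪gradient F x, gradient φ x⟫|)
        ≤ |deriv H (F x)| * (|2 * φ x| * (‖gradient F x‖ * ‖gradient φ x‖)) := by
          gcongr
      _ = 2 * |deriv H (F x)| * (‖gradient F x‖ * |φ x|) * ‖gradient φ x‖ := by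
          rw [abs_mul, abs_two]; ring
      _ ≤ ε * deriv H (F x) ^ 2 * (‖gradient F x‖ * |φ x|) ^ 2 + 1 / ε * 1 * ‖gradient φ x‖ ^ 2 := hY
      _ = _ := by rw [mul_pow, sq_abs, one_div]; ring
  -- integrability of the two right-hand sides (continuous with compact support)
  have hgradF : Continuous (gradient F) := continuous_gradient_of_contDiff hF
  have hgradφ : Continuous (gradient φ) := continuous_gradient_of_contDiff hφ
  have hc1 : Continuous fun x => deriv H (F x) ^ 2 * ‖gradient F x‖ ^ 2 * φ x ^ 2 :=
    (((hH'.comp hF.continuous).pow 2).mul (hgradF.norm.pow 2)).mul (hφ.continuous.pow 2)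
  have hφ2c : HasCompactSupport fun y => φ y ^ 2 :=
    hφc.comp_left (g := fun t : ℝ => t ^ 2) (by simp)
  have hi1 : Integrable (fun x => deriv H (F x) ^ 2 * ‖gradient F x‖ ^ 2 * φ x ^ 2)
      (volume : Measure (EuclideanSpace ℝ (Fin 3))) :=
    hc1.integrable_of_hasCompactSupport hφ2c.mul_left
  have hc2 : Continuous fun x => ‖gradient φ x‖ ^ 2 := hgradφ.norm.pow 2
  have hi2 : Integrable (fun x => ‖gradient φ x‖ ^ 2)
      (volume : Measure (EuclideanSpace ℝ (Fin 3))) :=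
    hc2.integrable_of_hasCompactSupport
      (HasCompactSupport.intro hφc fun x hx => by
        show ‖gradient φ x‖ ^ 2 = 0
        rw [gradient_eq_zero_of_notMem_tsupport hx, norm_zero, zero_pow two_ne_zero])
  -- integrate
  calc |∫ x, deriv H (F x) * ⟪gradient F x, gradient (fun y => φ y ^ 2) x⟫|
      ≤ ∫ x, |deriv H (F x) * ⟪gradient F x, gradient (fun y => φ y ^ 2) x⟫| :=
        abs_integral_le_integral_abs
    _ ≤ ∫ x, (ε * (deriv H (F x) ^ 2 * ‖gradient F x‖ ^ 2 * φ x ^ 2) +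
        ε⁻¹ * ‖gradient φ x‖ ^ 2) := by
        refine integral_mono_of_nonneg (Eventually.of_forall fun x => abs_nonneg _)
          ((hi1.const_mul ε).add (hi2.const_mul ε⁻¹)) (Eventually.of_forall hpt)
    _ = ε * (∫ x, deriv H (F x) ^ 2 * ‖gradient F x‖ ^ 2 * φ x ^ 2) +
        ε⁻¹ * ∫ x, ‖gradient φ x‖ ^ 2 := by
        rw [integral_add (hi1.const_mul ε) (hi2.const_mul ε⁻¹),
          MeasureTheory.integral_const_mul, MeasureTheory.integral_const_mul]

/-- **The transport term through the stream function for the logarithm** (Lei–Zhang 2011, proof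
of Lemma 3.2, p. 9, treatment of `b₂` up to the John–Nirenberg step): for `F ∈ C²`, any
`H ∈ C²`, a cut-off `φ ∈ C²_c`, a locally integrable drift `b = curl B` a.e. with `B`
differentiable, every constant `c` and `ε > 0`,
`|∫ H(F)⟪b, ∇(φ²)⟫| ≤ ε ∫ H'(F)²‖∇F‖²φ² + ε⁻¹ ∫ ‖B − c‖²‖∇φ‖²`
(`∫ H(F)⟪b, ∇φ²⟫ = ∫ ⟪B − c, ∇(H∘F) × ∇φ²⟫`, `|⟪B − c, ∇(H∘F) × ∇φ²⟫| ≤ ‖B − c‖ |H'(F)| ‖∇F‖ 2|φ|‖∇φ‖`,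
Young). [cite: LeiZhang2011, proof of Lemma 3.2 (arXiv p. 9), treatment of b₂] -/
theorem abs_integral_comp_inner_gradient_le_sq {F : EuclideanSpace ℝ (Fin 3) → ℝ}
    (hF : ContDiff ℝ 2 F) {H : ℝ → ℝ} (hH : ContDiff ℝ 2 H)
    {φ : EuclideanSpace ℝ (Fin 3) → ℝ} (hφ : ContDiff ℝ 2 φ) (hφc : HasCompactSupport φ)
    {Bst : EuclideanSpace ℝ (Fin 3) → EuclideanSpace ℝ (Fin 3)} (hBst : Differentiable ℝ Bst)
    {b : EuclideanSpace ℝ (Fin 3) → EuclideanSpace ℝ (Fin 3)} (hb : curl Bst =ᵐ[volume] b)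
    (hbi : LocallyIntegrable b volume) (c : EuclideanSpace ℝ (Fin 3)) {ε : ℝ} (hε : 0 < ε) :
    |∫ x, H (F x) * ⟪b x, gradient (fun y => φ y ^ 2) x⟫| ≤
      ε * (∫ x, deriv H (F x) ^ 2 * ‖gradient F x‖ ^ 2 * φ x ^ 2) +
        ε⁻¹ * ∫ x, ‖Bst x - c‖ ^ 2 * ‖gradient φ x‖ ^ 2 := by
  have hH1 : ContDiff ℝ 1 H := hH.of_le one_le_two
  have hH' : Continuous (deriv H) := hH.continuous_deriv (by norm_num)
  have hφ2c : HasCompactSupport fun y => φ y ^ 2 :=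
    hφc.comp_left (g := fun t : ℝ => t ^ 2) (by simp)
  -- through the stream function
  have hHF1 : ContDiff ℝ 1 fun x => H (F x) := hH1.comp (hF.of_le one_le_two)
  rw [integral_mul_inner_gradient_eq_integral_inner_sub_cross hBst hb hbi hHF1 (hφ.pow 2) hφ2c c]
  -- `∇(H∘F) = H'(F)∇F`, `∇(φ²) = 2φ∇φ`
  have hgradHF : ∀ x, gradient (fun y => H (F y)) x = deriv H (F x) • gradient F x := fun x =>
    gradient_comp_apply ((hH1.differentiable one_ne_zero) (F x)) ((hF.differentiable two_ne_zero) x)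
  have hgrad2 : ∀ x, gradient (fun y => φ y ^ 2) x = (2 * φ x) • gradient φ x := by
    intro x
    have hd : DifferentiableAt ℝ φ x := (hφ.differentiable two_ne_zero) x
    have h := gradient_comp_apply (H := fun t : ℝ => t ^ 2) (F := φ)
      ((differentiable_pow 2) (φ x)) hd
    simp only [deriv_pow_field, Nat.cast_ofNat, Nat.add_one_sub_one, pow_one] at h
    exact h
  -- pointwise Young with `h₀ = 1`, `h₂ = h₁²`, `κ = 1`
  have hpt : ∀ x, |⟪Bst x - c, cross (gradient (fun y => H (F y)) x) (gradient (fun y => φ y ^ 2) x)⟫| ≤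
      ε * (deriv H (F x) ^ 2 * ‖gradient F x‖ ^ 2 * φ x ^ 2) +
        ε⁻¹ * (‖Bst x - c‖ ^ 2 * ‖gradient φ x‖ ^ 2) := by
    intro x
    have h1 := abs_inner_sub_cross_gradient_le Bst c (fun y => H (F y)) (fun y => φ y ^ 2) x
    have hn1 : ‖gradient (fun y => H (F y)) x‖ = |deriv H (F x)| * ‖gradient F x‖ := by
      rw [hgradHF x, norm_smul, Real.norm_eq_abs]
    have hn2 : ‖gradient (fun y => φ y ^ 2) x‖ = 2 * |φ x| * ‖gradient φ x‖ := by
      rw [hgrad2 x, norm_smul, Real.norm_eq_abs, abs_mul, abs_two]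
    rw [hn1, hn2] at h1
    have hY := two_mul_abs_mul_mul_le (h₀ := 1) (h₁ := deriv H (F x)) (h₂ := deriv H (F x) ^ 2)
      (κ := 1) (‖gradient F x‖ * |φ x|) (‖Bst x - c‖ * ‖gradient φ x‖) hε zero_le_one zero_le_one
      (sq_nonneg _) (by rw [mul_one, one_mul])
    calc |⟪Bst x - c, cross (gradient (fun y => H (F y)) x) (gradient (fun y => φ y ^ 2) x)⟫|
        ≤ ‖Bst x - c‖ * (|deriv H (F x)| * ‖gradient F x‖ * (2 * |φ x| * ‖gradient φ x‖)) := h1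
      _ = 2 * |deriv H (F x)| * (‖gradient F x‖ * |φ x|) * (‖Bst x - c‖ * ‖gradient φ x‖) := by
          ring
      _ ≤ ε * deriv H (F x) ^ 2 * (‖gradient F x‖ * |φ x|) ^ 2 +
            1 / ε * 1 * (‖Bst x - c‖ * ‖gradient φ x‖) ^ 2 := hY
      _ = _ := by rw [mul_pow, mul_pow, sq_abs, one_div]; ring
  -- integrability of the two bounds
  have hgradF : Continuous (gradient F) := continuous_gradient_of_contDiff (hF.of_le one_le_two)
  have hgradφ : Continuous (gradient φ) := continuous_gradient_of_contDiff (hφ.of_le one_le_two)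
  have hc1 : Continuous fun x => deriv H (F x) ^ 2 * ‖gradient F x‖ ^ 2 * φ x ^ 2 :=
    (((hH'.comp hF.continuous).pow 2).mul (hgradF.norm.pow 2)).mul (hφ.continuous.pow 2)
  have hc2 : Continuous fun x => ‖Bst x - c‖ ^ 2 * ‖gradient φ x‖ ^ 2 :=
    ((hBst.continuous.sub continuous_const).norm.pow 2).mul (hgradφ.norm.pow 2)
  have hi1 : Integrable (fun x => deriv H (F x) ^ 2 * ‖gradient F x‖ ^ 2 * φ x ^ 2)
      (volume : Measure (EuclideanSpace ℝ (Fin 3))) :=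
    hc1.integrable_of_hasCompactSupport hφ2c.mul_left
  have hi2 : Integrable (fun x => ‖Bst x - c‖ ^ 2 * ‖gradient φ x‖ ^ 2)
      (volume : Measure (EuclideanSpace ℝ (Fin 3))) :=
    hc2.integrable_of_hasCompactSupport
      (HasCompactSupport.intro hφc fun x hx => by
        show ‖Bst x - c‖ ^ 2 * ‖gradient φ x‖ ^ 2 = 0
        rw [gradient_eq_zero_of_notMem_tsupport hx, norm_zero, zero_pow two_ne_zero, mul_zero])
  calc |∫ x, ⟪Bst x - c, cross (gradient (fun y => H (F y)) x) (gradient (fun y => φ y ^ 2) x)⟫|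
      ≤ ∫ x, |⟪Bst x - c, cross (gradient (fun y => H (F y)) x) (gradient (fun y => φ y ^ 2) x)⟫| :=
        abs_integral_le_integral_abs
    _ ≤ ∫ x, (ε * (deriv H (F x) ^ 2 * ‖gradient F x‖ ^ 2 * φ x ^ 2) +
          ε⁻¹ * (‖Bst x - c‖ ^ 2 * ‖gradient φ x‖ ^ 2)) :=
        integral_mono_of_nonneg (Eventually.of_forall fun x => abs_nonneg _)
          ((hi1.const_mul ε).add (hi2.const_mul ε⁻¹)) (Eventually.of_forall hpt)
    _ = _ := by
        rw [integral_add (hi1.const_mul ε) (hi2.const_mul ε⁻¹),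
          MeasureTheory.integral_const_mul, MeasureTheory.integral_const_mul]


/-! ### The weighted Poincaré inequality for the squared radial cut-off -/

/-- The radial cut-off is non-increasing in the norm. [folklore] -/
theorem radialCutoff_anti {ρ₂ ρ₁ : ℝ} (h : ρ₂ < ρ₁) (h₀ : 0 ≤ ρ₂) {x y : EuclideanSpace ℝ (Fin 3)}
    (hxy : ‖x‖ ≤ ‖y‖) : radialCutoff ρ₂ ρ₁ y ≤ radialCutoff ρ₂ ρ₁ x := by
  simp only [radialCutoff, cutoffProfile]
  refine Real.smoothTransition.monotone (div_le_div_of_nonneg_right ?_ ?_)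
  · have := pow_le_pow_left₀ (norm_nonneg x) hxy 2
    linarith
  · have : ρ₂ ^ 2 < ρ₁ ^ 2 := pow_lt_pow_left₀ h h₀ two_ne_zero
    linarith

/-- **The weighted Poincaré inequality (3.4) of Lei–Zhang 2011 for the squared radial cut-off.**
For `ρ > 0`, `φ = radialCutoff (ρ/2) ρ` and `Ψ ∈ C¹(ℝ³)`,
`∫ |Ψ − Ψ̄|² φ² ≤ 256 ρ² ∫ ‖∇Ψ‖² φ²` with the weighted mean `Ψ̄ = (∫ Ψ φ²)/(∫ φ²)`: Moser's
lemma (`lintegral_enorm_sub_average_sq_le_of_quasiconcave_weight`, weight `ω = φ²` radially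
non-increasing hence quasi-concave along segments, `Q = B̄(0,ρ)`, `D = 2ρ`, `W = 1`,
`|Q|/∫φ² ≤ |B̄_ρ|/|B̄_{ρ/2}| = 8`, `2³·(2ρ)²·8 = 256ρ²`). [cite: LeiZhang2011, (3.4) (arXiv p. 9)] -/
theorem integral_sub_average_sq_mul_radialCutoff_sq_le {ρ : ℝ} (hρ : 0 < ρ)
    {Ψ : EuclideanSpace ℝ (Fin 3) → ℝ} (hΨ : ContDiff ℝ 1 Ψ) :
    ∫ x, (Ψ x - (∫ y, Ψ y * radialCutoff (ρ / 2) ρ y ^ 2) /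
        (∫ y : EuclideanSpace ℝ (Fin 3), radialCutoff (ρ / 2) ρ y ^ 2)) ^ 2 * radialCutoff (ρ / 2) ρ x ^ 2 ≤
      256 * ρ ^ 2 * ∫ x, ‖gradient Ψ x‖ ^ 2 * radialCutoff (ρ / 2) ρ x ^ 2 := by
  set φ : EuclideanSpace ℝ (Fin 3) → ℝ := radialCutoff (ρ / 2) ρ with hφdef
  have hρ2 : 0 ≤ ρ / 2 := by positivity
  have hρρ : ρ / 2 < ρ := half_lt_self hρ
  have hφC : ContDiff ℝ 1 φ := radialCutoff_contDiff _ _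
  have hφc : Continuous φ := hφC.continuous
  have hφ0 : ∀ x, 0 ≤ φ x := fun x => radialCutoff_nonneg _ _ _
  have hφ1 : ∀ x, φ x ≤ 1 := fun x => radialCutoff_le_one _ _ _
  have hφK : ∀ x, x ∉ closedBall (0 : EuclideanSpace ℝ (Fin 3)) ρ → φ x = 0 := fun x hx =>
    radialCutoff_eq_zero hρ2 hρρ (le_of_lt (by rwa [mem_closedBall_zero_iff, not_le] at hx))
  have hφone : ∀ x ∈ closedBall (0 : EuclideanSpace ℝ (Fin 3)) (ρ / 2), φ x = 1 := fun x hx =>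
    radialCutoff_eq_one hρ2 hρρ (mem_closedBall_zero_iff.1 hx)
  have hφcs : HasCompactSupport φ := hasCompactSupport_radialCutoff hρ2 hρρ
  have hφ2cs : HasCompactSupport fun x => φ x ^ 2 := hφcs.comp_left (g := fun t : ℝ => t ^ 2) (by simp)
  have hφ2i : Integrable (fun x => φ x ^ 2) (volume : Measure (EuclideanSpace ℝ (Fin 3))) :=
    (hφc.pow 2).integrable_of_hasCompactSupport hφ2cs
  -- the normalisation `Z = ∫ φ² ≥ |B̄(0, ρ/2)| > 0`
  set Z : ℝ := ∫ y, φ y ^ 2 with hZ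
  have hVhalf : volume.real (closedBall (0 : EuclideanSpace ℝ (Fin 3)) (ρ / 2)) ≤ Z := by
    calc volume.real (closedBall (0 : EuclideanSpace ℝ (Fin 3)) (ρ / 2))
        = ∫ x in closedBall (0 : EuclideanSpace ℝ (Fin 3)) (ρ / 2), φ x ^ 2 := by
          rw [setIntegral_congr_fun measurableSet_closedBall (g := fun _ => (1 : ℝ))
            (fun x hx => by simp only [hφone x hx, one_pow]), setIntegral_const, smul_eq_mul, mul_one]
      _ ≤ Z := setIntegral_le_integral hφ2i (ae_of_all _ fun x => sq_nonneg _)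
  have hVpos : 0 < volume.real (closedBall (0 : EuclideanSpace ℝ (Fin 3)) (ρ / 2)) := by
    rw [measureReal_def]
    exact ENNReal.toReal_pos (measure_closedBall_pos volume _ (by positivity)).ne'
      measure_closedBall_lt_top.ne
  have hZpos : 0 < Z := hVpos.trans_le hVhalf
  -- the weight
  set ω : EuclideanSpace ℝ (Fin 3) → ℝ≥0∞ := fun x => ENNReal.ofReal (φ x ^ 2) with hωdef
  have hωm : Measurable ω := ENNReal.measurable_ofReal.comp (hφc.pow 2).measurable
  have hωQ : ∀ x, x ∉ closedBall (0 : EuclideanSpace ℝ (Fin 3)) ρ → ω x = 0 := fun x hx => by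
    simp only [hωdef, hφK x hx]; simp
  have hω1 : ∀ x, ω x ≤ 1 := fun x => by
    simp only [hωdef]
    rw [← ENNReal.ofReal_one]
    exact ENNReal.ofReal_le_ofReal (pow_le_one₀ (hφ0 x) (hφ1 x))
  have hωtop : ∀ᵐ x ∂(volume : Measure (EuclideanSpace ℝ (Fin 3))), ω x < ∞ :=
    ae_of_all _ fun x => ENNReal.ofReal_lt_top
  have hωtoReal : ∀ x, (ω x).toReal = φ x ^ 2 := fun x => ENNReal.toReal_ofReal (sq_nonneg _)
  have hlintω : ∫⁻ x, ω x = ENNReal.ofReal Z := by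
    rw [hZ, ofReal_integral_eq_lintegral_ofReal hφ2i (ae_of_all _ fun x => sq_nonneg _)]
  have hω0 : ∫⁻ x, ω x ≠ 0 := by
    rw [hlintω]; exact (ENNReal.ofReal_pos.2 hZpos).ne'
  -- quasi-concavity along segments: `φ` is radially non-increasing
  have hqc : ∀ y ∈ closedBall (0 : EuclideanSpace ℝ (Fin 3)) ρ, ∀ z ∈ closedBall (0 : EuclideanSpace ℝ (Fin 3)) ρ,
      ∀ τ ∈ Icc (0 : ℝ) 1, min (ω y) (ω z) ≤ ω (z + τ • (y - z)) := by
    intro y _ z _ τ hτ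
    have hseg : ‖z + τ • (y - z)‖ ≤ max ‖y‖ ‖z‖ := by
      have e : z + τ • (y - z) = (1 - τ) • z + τ • y := by
        simp only [smul_sub, sub_smul, one_smul]; abel
      rw [e]
      calc ‖(1 - τ) • z + τ • y‖ ≤ ‖(1 - τ) • z‖ + ‖τ • y‖ := norm_add_le _ _
        _ = (1 - τ) * ‖z‖ + τ * ‖y‖ := by
            rw [norm_smul, norm_smul, Real.norm_eq_abs, Real.norm_eq_abs,
              abs_of_nonneg (by linarith [hτ.2]), abs_of_nonneg hτ.1]
        _ ≤ (1 - τ) * max ‖y‖ ‖z‖ + τ * max ‖y‖ ‖z‖ := by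
            gcongr
            · linarith [hτ.2]
            · exact le_max_right _ _
            · exact hτ.1
            · exact le_max_left _ _
        _ = max ‖y‖ ‖z‖ := by ring
    have hmono : ∀ a b : EuclideanSpace ℝ (Fin 3), φ a ≤ φ b → ω a ≤ ω b := fun a b hab =>
      ENNReal.ofReal_le_ofReal (pow_le_pow_left₀ (hφ0 a) hab 2)
    rcases le_total ‖y‖ ‖z‖ with h | h
    · rw [max_eq_right h] at hseg
      exact (min_le_right _ _).trans (hmono _ _ (radialCutoff_anti hρρ hρ2 hseg))
    · rw [max_eq_left h] at hseg
      exact (min_le_left _ _).trans (hmono _ _ (radialCutoff_anti hρρ hρ2 hseg))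
  -- integrability of `Ψ` for `ν = φ² dx`
  set ν : Measure (EuclideanSpace ℝ (Fin 3)) := volume.withDensity ω with hν
  have hΨc : Continuous Ψ := hΨ.continuous
  have hΨi : Integrable Ψ ν := by
    rw [hν, integrable_withDensity_iff_integrable_smul' hωm hωtop]
    have h : Continuous fun x => φ x ^ 2 * Ψ x := (hφc.pow 2).mul hΨc
    refine (h.integrable_of_hasCompactSupport hφ2cs.mul_right).congr (ae_of_all _ fun x => ?_)
    simp only [hωtoReal x, smul_eq_mul]
  have hD : ∀ y ∈ closedBall (0 : EuclideanSpace ℝ (Fin 3)) ρ, ∀ z ∈ closedBall (0 : EuclideanSpace ℝ (Fin 3)) ρ,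
      ‖y - z‖ ≤ 2 * ρ := by
    intro y hy z hz
    rw [mem_closedBall_zero_iff] at hy hz
    calc ‖y - z‖ ≤ ‖y‖ + ‖z‖ := norm_sub_le _ _
      _ ≤ 2 * ρ := by linarith
  -- Moser's lemma
  have hP := Literature.Analysis.FunctionSpaces.lintegral_enorm_sub_average_sq_le_of_quasiconcave_weight
    (volume : Measure (EuclideanSpace ℝ (Fin 3))) hΨ (convex_closedBall 0 ρ) measurableSet_closedBall
    measure_closedBall_lt_top.ne hωm hωQ ENNReal.one_ne_top hω1 hqc hω0 hΨi hD
  -- the weighted mean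
  set m : ℝ := (∫ y, Ψ y * φ y ^ 2) / Z with hm
  have hνuniv : ν univ = ENNReal.ofReal Z := by
    rw [hν, withDensity_apply _ MeasurableSet.univ, Measure.restrict_univ, hlintω]
  have havg : ⨍ z, Ψ z ∂ν = m := by
    rw [average_eq, measureReal_def, hνuniv, ENNReal.toReal_ofReal hZpos.le, hν,
      integral_withDensity_eq_integral_toReal_smul hωm hωtop, smul_eq_mul, hm, div_eq_inv_mul]
    congr 1
    refine integral_congr_ae (ae_of_all _ fun x => ?_)
    simp only [hωtoReal x, smul_eq_mul]
    ring
  -- the left-hand side as a real integral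
  have hint1 : Integrable (fun x => (Ψ x - m) ^ 2 * φ x ^ 2) (volume : Measure (EuclideanSpace ℝ (Fin 3))) :=
    (((hΨc.sub continuous_const).pow 2).mul (hφc.pow 2)).integrable_of_hasCompactSupport hφ2cs.mul_left
  have hgm1 : Measurable fun y => ‖Ψ y - m‖ₑ ^ 2 :=
    (hΨc.sub (continuous_const (y := m))).measurable.enorm.pow_const _
  have hL : ∫⁻ y, ‖Ψ y - ⨍ z, Ψ z ∂ν‖ₑ ^ 2 ∂ν = ENNReal.ofReal (∫ x, (Ψ x - m) ^ 2 * φ x ^ 2) := by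
    rw [havg, hν, lintegral_withDensity_eq_lintegral_mul₀ hωm.aemeasurable hgm1.aemeasurable,
      ofReal_integral_eq_lintegral_ofReal hint1 (ae_of_all _ fun x => by positivity)]
    refine lintegral_congr fun x => ?_
    simp only [Pi.mul_apply, hωdef]
    rw [Real.enorm_eq_ofReal_abs, ← ENNReal.ofReal_pow (abs_nonneg _), sq_abs,
      ← ENNReal.ofReal_mul (sq_nonneg _), mul_comm]
  -- the right-hand side as a real integral
  have hgradc : Continuous fun x => ‖gradient Ψ x‖ ^ 2 := (continuous_gradient_of_contDiff hΨ).norm.pow 2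
  have hint2 : Integrable (fun x => ‖gradient Ψ x‖ ^ 2 * φ x ^ 2) (volume : Measure (EuclideanSpace ℝ (Fin 3))) :=
    (hgradc.mul (hφc.pow 2)).integrable_of_hasCompactSupport hφ2cs.mul_left
  have hgm2 : Measurable fun y => ‖fderiv ℝ Ψ y‖ₑ ^ 2 :=
    (hΨ.continuous_fderiv one_ne_zero).measurable.enorm.pow_const _
  have hR : ∫⁻ y, ‖fderiv ℝ Ψ y‖ₑ ^ 2 ∂ν = ENNReal.ofReal (∫ x, ‖gradient Ψ x‖ ^ 2 * φ x ^ 2) := by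
    rw [hν, lintegral_withDensity_eq_lintegral_mul₀ hωm.aemeasurable hgm2.aemeasurable,
      ofReal_integral_eq_lintegral_ofReal hint2 (ae_of_all _ fun x => by positivity)]
    refine lintegral_congr fun x => ?_
    simp only [Pi.mul_apply, hωdef]
    rw [← ofReal_norm, ← ENNReal.ofReal_pow (norm_nonneg _), ← ENNReal.ofReal_mul (sq_nonneg _),
      mul_comm, gradient, LinearIsometryEquiv.norm_map]
  -- the constant: `2³ (2ρ)² · 1 · |B̄_ρ| / Z ≤ 256 ρ²`
  have hfin : Module.finrank ℝ (EuclideanSpace ℝ (Fin 3)) = 3 := finrank_euclideanSpace_fin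
  have hVQ : volume (closedBall (0 : EuclideanSpace ℝ (Fin 3)) ρ) =
      ENNReal.ofReal (volume.real (closedBall (0 : EuclideanSpace ℝ (Fin 3)) ρ)) :=
    (ofReal_measureReal measure_closedBall_lt_top.ne).symm
  have hV8 : volume.real (closedBall (0 : EuclideanSpace ℝ (Fin 3)) ρ) ≤ 8 * Z := by
    have h1 := Measure.addHaar_real_closedBall (volume : Measure (EuclideanSpace ℝ (Fin 3))) (0 : EuclideanSpace ℝ (Fin 3)) hρ.le
    have h2 := Measure.addHaar_real_closedBall (volume : Measure (EuclideanSpace ℝ (Fin 3))) (0 : EuclideanSpace ℝ (Fin 3)) hρ2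
    rw [hfin] at h1 h2
    have h3 : volume.real (closedBall (0 : EuclideanSpace ℝ (Fin 3)) ρ) =
        8 * volume.real (closedBall (0 : EuclideanSpace ℝ (Fin 3)) (ρ / 2)) := by
      rw [h1, h2]; ring
    rw [h3]
    exact mul_le_mul_of_nonneg_left hVhalf (by norm_num)
  rw [hL, hR, hfin, hlintω, hVQ, mul_one, ← ENNReal.ofReal_inv_of_pos hZpos] at hP
  have hc0 : (0 : ℝ) ≤ 2 ^ 3 * (2 * ρ) ^ 2 := by positivity
  have hVQ0 : 0 ≤ volume.real (closedBall (0 : EuclideanSpace ℝ (Fin 3)) ρ) := measureReal_nonneg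
  have hBg0 : 0 ≤ ∫ x, ‖gradient Ψ x‖ ^ 2 * φ x ^ 2 := integral_nonneg fun x => by positivity
  have hZi0 : 0 ≤ Z⁻¹ := inv_nonneg.2 hZpos.le
  rw [← ENNReal.ofReal_mul hc0, ← ENNReal.ofReal_mul (mul_nonneg hc0 hVQ0),
    ← ENNReal.ofReal_mul (mul_nonneg (mul_nonneg hc0 hVQ0) hZi0),
    ENNReal.ofReal_le_ofReal_iff (mul_nonneg (mul_nonneg (mul_nonneg hc0 hVQ0) hZi0) hBg0)] at hP
  calc ∫ x, (Ψ x - m) ^ 2 * φ x ^ 2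
      ≤ 2 ^ 3 * (2 * ρ) ^ 2 * volume.real (closedBall (0 : EuclideanSpace ℝ (Fin 3)) ρ) * Z⁻¹ *
          ∫ x, ‖gradient Ψ x‖ ^ 2 * φ x ^ 2 := hP
    _ ≤ 2 ^ 3 * (2 * ρ) ^ 2 * (8 * Z) * Z⁻¹ * ∫ x, ‖gradient Ψ x‖ ^ 2 * φ x ^ 2 := by gcongr
    _ = 256 * ρ ^ 2 * ∫ x, ‖gradient Ψ x‖ ^ 2 * φ x ^ 2 := by
        field_simp
        ring


/-! ### The axis term for the logarithm -/

/-- `‖(0,0,z)‖ = |z|`. [folklore] -/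
theorem norm_meridianPoint_zero (z : ℝ) : ‖meridianPoint (0, z)‖ = |z| := by
  rw [EuclideanSpace.norm_eq, Fin.sum_univ_three]
  simp [meridianPoint_apply_zero, meridianPoint_apply_one, meridianPoint_apply_two, Real.sqrt_sq_eq_abs]

/-- The mass of the squared radial cut-off: `(ρ/2)³|B₁| ≤ ∫ φ² ≤ ρ³|B₁|` for
`φ = radialCutoff (ρ/2) ρ`. [folklore] -/
theorem radialCutoff_sq_mass {ρ : ℝ} (hρ : 0 < ρ) :
    (ρ / 2) ^ 3 * volume.real (ball (0 : EuclideanSpace ℝ (Fin 3)) 1) ≤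
        ∫ y : EuclideanSpace ℝ (Fin 3), radialCutoff (ρ / 2) ρ y ^ 2 ∧
      ∫ y : EuclideanSpace ℝ (Fin 3), radialCutoff (ρ / 2) ρ y ^ 2 ≤
        ρ ^ 3 * volume.real (ball (0 : EuclideanSpace ℝ (Fin 3)) 1) := by
  set φ : EuclideanSpace ℝ (Fin 3) → ℝ := radialCutoff (ρ / 2) ρ with hφdef
  have hρ2 : 0 ≤ ρ / 2 := by positivity
  have hρρ : ρ / 2 < ρ := half_lt_self hρ
  have hφc : Continuous φ := (radialCutoff_contDiff (ρ / 2) ρ (n := 0)).continuous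
  have hφ0 : ∀ x, 0 ≤ φ x := fun x => radialCutoff_nonneg _ _ _
  have hφ1 : ∀ x, φ x ≤ 1 := fun x => radialCutoff_le_one _ _ _
  have hφK : ∀ x, x ∉ closedBall (0 : EuclideanSpace ℝ (Fin 3)) ρ → φ x = 0 := fun x hx =>
    radialCutoff_eq_zero hρ2 hρρ (le_of_lt (by rwa [mem_closedBall_zero_iff, not_le] at hx))
  have hφone : ∀ x ∈ closedBall (0 : EuclideanSpace ℝ (Fin 3)) (ρ / 2), φ x = 1 := fun x hx =>
    radialCutoff_eq_one hρ2 hρρ (mem_closedBall_zero_iff.1 hx)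
  have hφcs : HasCompactSupport φ := hasCompactSupport_radialCutoff hρ2 hρρ
  have hφ2cs : HasCompactSupport fun x => φ x ^ 2 := hφcs.comp_left (g := fun t : ℝ => t ^ 2) (by simp)
  have hφ2c : Continuous fun x => φ x ^ 2 := hφc.pow 2
  have hφ2i : Integrable (fun x => φ x ^ 2) (volume : Measure (EuclideanSpace ℝ (Fin 3))) :=
    hφ2c.integrable_of_hasCompactSupport hφ2cs
  have hfin : Module.finrank ℝ (EuclideanSpace ℝ (Fin 3)) = 3 := finrank_euclideanSpace_fin
  have h1 := Measure.addHaar_real_closedBall (volume : Measure (EuclideanSpace ℝ (Fin 3)))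
    (0 : EuclideanSpace ℝ (Fin 3)) hρ.le
  have h2 := Measure.addHaar_real_closedBall (volume : Measure (EuclideanSpace ℝ (Fin 3)))
    (0 : EuclideanSpace ℝ (Fin 3)) hρ2
  rw [hfin] at h1 h2
  constructor
  · rw [← h2]
    calc volume.real (closedBall (0 : EuclideanSpace ℝ (Fin 3)) (ρ / 2))
        = ∫ x in closedBall (0 : EuclideanSpace ℝ (Fin 3)) (ρ / 2), φ x ^ 2 := by
          rw [setIntegral_congr_fun measurableSet_closedBall (g := fun _ => (1 : ℝ))
            (fun x hx => by simp only [hφone x hx, one_pow]), setIntegral_const, smul_eq_mul, mul_one]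
      _ ≤ ∫ x, φ x ^ 2 := setIntegral_le_integral hφ2i (ae_of_all _ fun x => sq_nonneg _)
  · rw [← h1]
    calc ∫ x, φ x ^ 2 = ∫ x in closedBall (0 : EuclideanSpace ℝ (Fin 3)) ρ, φ x ^ 2 := by
          refine (setIntegral_eq_integral_of_forall_compl_eq_zero fun x hx => ?_).symm
          rw [hφK x hx]; ring
      _ ≤ ∫ x in closedBall (0 : EuclideanSpace ℝ (Fin 3)) ρ, (1 : ℝ) :=
          setIntegral_mono_on hφ2i.integrableOn (integrableOn_const measure_closedBall_lt_top.ne)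
            measurableSet_closedBall fun x _ => pow_le_one₀ (hφ0 x) (hφ1 x)
      _ = volume.real (closedBall (0 : EuclideanSpace ℝ (Fin 3)) ρ) := by
          rw [setIntegral_const, smul_eq_mul, mul_one]

/-- The axis mass of the squared radial cut-off: `ρ ≤ ∫ φ(0,0,z)² dz ≤ 2ρ` for
`φ = radialCutoff (ρ/2) ρ` (`φ(0,0,z) = 1` for `|z| ≤ ρ/2`, `= 0` for `|z| ≥ ρ`). [folklore] -/
theorem radialCutoff_sq_axis_mass {ρ : ℝ} (hρ : 0 < ρ) :
    ρ ≤ ∫ z : ℝ, radialCutoff (ρ / 2) ρ (meridianPoint (0, z)) ^ 2 ∧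
      ∫ z : ℝ, radialCutoff (ρ / 2) ρ (meridianPoint (0, z)) ^ 2 ≤ 2 * ρ := by
  set φ : EuclideanSpace ℝ (Fin 3) → ℝ := radialCutoff (ρ / 2) ρ with hφdef
  have hρ2 : 0 ≤ ρ / 2 := by positivity
  have hρρ : ρ / 2 < ρ := half_lt_self hρ
  have hφc : Continuous φ := (radialCutoff_contDiff (ρ / 2) ρ (n := 0)).continuous
  have hφ0 : ∀ x, 0 ≤ φ x := fun x => radialCutoff_nonneg _ _ _
  have hφ1 : ∀ x, φ x ≤ 1 := fun x => radialCutoff_le_one _ _ _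
  have hmpc : Continuous fun z : ℝ => meridianPoint (0, z) :=
    (contDiff_meridianPoint (n := 0)).continuous.comp (continuous_const.prodMk continuous_id)
  have hg0 : ∀ z : ℝ, z ∉ Icc (-ρ) ρ → φ (meridianPoint (0, z)) ^ 2 = 0 := by
    intro z hz
    rw [mem_Icc, ← abs_le, not_le] at hz
    have h : φ (meridianPoint (0, z)) = 0 :=
      radialCutoff_eq_zero hρ2 hρρ (by rw [norm_meridianPoint_zero]; exact hz.le)
    rw [h, zero_pow two_ne_zero]
  have hg1 : ∀ z ∈ Icc (-(ρ / 2)) (ρ / 2), φ (meridianPoint (0, z)) ^ 2 = 1 := by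
    intro z hz
    have h : φ (meridianPoint (0, z)) = 1 :=
      radialCutoff_eq_one hρ2 hρρ (by rw [norm_meridianPoint_zero]; exact abs_le.2 ⟨hz.1, hz.2⟩)
    rw [h, one_pow]
  have hgc : Continuous fun z : ℝ => φ (meridianPoint (0, z)) ^ 2 := (hφc.comp hmpc).pow 2
  have hgi : Integrable (fun z : ℝ => φ (meridianPoint (0, z)) ^ 2) volume :=
    hgc.integrable_of_hasCompactSupport (HasCompactSupport.intro isCompact_Icc fun z hz => hg0 z hz)
  have hρhalf : -(ρ / 2) ≤ ρ / 2 := by linarith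
  have hρρ' : -ρ ≤ ρ := by linarith
  constructor
  · calc ρ = ∫ z in Icc (-(ρ / 2)) (ρ / 2), (1 : ℝ) := by
          rw [setIntegral_const, smul_eq_mul, mul_one, Real.volume_real_Icc_of_le hρhalf]; ring
      _ = ∫ z in Icc (-(ρ / 2)) (ρ / 2), φ (meridianPoint (0, z)) ^ 2 :=
          (setIntegral_congr_fun measurableSet_Icc fun z hz => (hg1 z hz)).symm
      _ ≤ ∫ z, φ (meridianPoint (0, z)) ^ 2 := setIntegral_le_integral hgi (ae_of_all _ fun z => sq_nonneg _)
  · calc ∫ z, φ (meridianPoint (0, z)) ^ 2 = ∫ z in Icc (-ρ) ρ, φ (meridianPoint (0, z)) ^ 2 :=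
          (setIntegral_eq_integral_of_forall_compl_eq_zero fun z hz => hg0 z hz).symm
      _ ≤ ∫ z in Icc (-ρ) ρ, (1 : ℝ) :=
          setIntegral_mono_on hgi.integrableOn (integrableOn_const (by rw [Real.volume_Icc]; exact ENNReal.ofReal_ne_top))
            measurableSet_Icc fun z _ => pow_le_one₀ (hφ0 _) (hφ1 _)
      _ = 2 * ρ := by rw [setIntegral_const, smul_eq_mul, mul_one, Real.volume_real_Icc_of_le hρρ']; ring

/-- The axis integral of the derivative of the squared cut-off:
`∫ (2/r) ∂ᵣ(φ²) dx = −2c₂ ∫ φ(0,0,z)² dz` (`integral_axis_term_eq_sub_boundary` with `H ≡ 1`).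
This is "`4π∫(Ψ − Ψ̄)∂ᵣζ² … − 4πΨ̄∫ζ²dz|_{r=0}`" of Lei–Zhang 2011, p. 9. [cite: LeiZhang2011, proof of Lemma 3.2 (arXiv p. 9), the axis term] -/
theorem integral_axis_weight_radialCutoff_sq {ρ : ℝ} (hρ : 0 < ρ) :
    Integrable (fun x : EuclideanSpace ℝ (Fin 3) => 2 / cylRadius x *
        fderiv ℝ (fun y => (radialCutoff (ρ / 2) ρ : EuclideanSpace ℝ (Fin 3) → ℝ) y ^ 2) x (eR x)) volume ∧
      ∫ x : EuclideanSpace ℝ (Fin 3), 2 / cylRadius x *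
          fderiv ℝ (fun y => (radialCutoff (ρ / 2) ρ : EuclideanSpace ℝ (Fin 3) → ℝ) y ^ 2) x (eR x) =
        -(2 * radialConst₂ * ∫ z : ℝ, radialCutoff (ρ / 2) ρ (meridianPoint (0, z)) ^ 2) := by
  set φ : EuclideanSpace ℝ (Fin 3) → ℝ := radialCutoff (ρ / 2) ρ with hφdef
  have hρ2 : 0 ≤ ρ / 2 := by positivity
  have hρρ : ρ / 2 < ρ := half_lt_self hρ
  have hφC : ContDiff ℝ 1 φ := radialCutoff_contDiff _ _
  have hφcs : HasCompactSupport φ := hasCompactSupport_radialCutoff hρ2 hρρ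
  have hφa : IsAxisymmetricScalar φ := radialCutoff_axisymmetric _ _
  obtain ⟨-, hi, heq⟩ := integral_axis_term_eq_sub_boundary (F := φ) hφC hφa (H := fun _ => (1 : ℝ))
    contDiff_const hφC hφcs hφa
  simp only [deriv_const', zero_mul, mul_zero, integral_zero, one_mul] at hi heq
  refine ⟨hi, ?_⟩
  linarith

/-- **The axis term for the logarithm** (Lei–Zhang 2011, proof of Lemma 3.2, p. 9:
"`−∫(4π/r)∂ᵣΨζ² r dr dθ dz = … ≤ C − CΨ̄(s) + ⅛∫|∇Ψ|²ζ²`"). For `ρ > 0`, `φ = radialCutoff (ρ/2) ρ`,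
an axisymmetric `Ψ ∈ C¹` and `δ > 0`: with `Z = ∫φ²`, `Ψ̄ = (∫Ψφ²)/Z`, `A = 2c₂∫φ(0,0,z)²dz`,
`∫ (2/r) Ψ ∂ᵣ(φ²) ≤ δ ∫‖∇Ψ‖²φ² + (64ρ²/δ)(32C_T/(3ρ²))² |B̄_ρ| − (A/Z) ∫Ψφ²`: split
`Ψ = (Ψ − Ψ̄) + Ψ̄`, `∫(2/r)∂ᵣφ² = −A` (`integral_axis_weight_radialCutoff_sq`),
`|(2/r)∂ᵣφ²| ≤ (32C_T/(3ρ²)) φ` (`abs_axis_weight_radialCutoff_sq_le`), Young and the weighted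
Poincaré inequality `integral_sub_average_sq_mul_radialCutoff_sq_le`. [cite: LeiZhang2011, proof of Lemma 3.2 (arXiv p. 9), the axis term] -/
theorem integral_axis_term_log_le {ρ : ℝ} (hρ : 0 < ρ) {Ψ : EuclideanSpace ℝ (Fin 3) → ℝ}
    (hΨ : ContDiff ℝ 1 Ψ) (hΨa : IsAxisymmetricScalar Ψ) {CT : ℝ}
    (hCT : ∀ t, |deriv Real.smoothTransition t| ≤ CT) {δ : ℝ} (hδ : 0 < δ) :
    ∫ x, 2 / cylRadius x * (Ψ x *
        fderiv ℝ (fun y => (radialCutoff (ρ / 2) ρ : EuclideanSpace ℝ (Fin 3) → ℝ) y ^ 2) x (eR x)) ≤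
      δ * (∫ x, ‖gradient Ψ x‖ ^ 2 * radialCutoff (ρ / 2) ρ x ^ 2) +
        64 * ρ ^ 2 / δ * (32 * CT / (3 * ρ ^ 2)) ^ 2 * (ρ ^ 3 * volume.real (ball (0 : EuclideanSpace ℝ (Fin 3)) 1)) -
        (2 * radialConst₂ * ∫ z : ℝ, radialCutoff (ρ / 2) ρ (meridianPoint (0, z)) ^ 2) /
            (∫ y : EuclideanSpace ℝ (Fin 3), radialCutoff (ρ / 2) ρ y ^ 2) *
          ∫ x, Ψ x * radialCutoff (ρ / 2) ρ x ^ 2 := by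
  obtain ⟨hwi, hw⟩ := integral_axis_weight_radialCutoff_sq hρ
  obtain ⟨hZlo, hZhi⟩ := radialCutoff_sq_mass hρ
  have hP := integral_sub_average_sq_mul_radialCutoff_sq_le hρ hΨ
  set φ : EuclideanSpace ℝ (Fin 3) → ℝ := radialCutoff (ρ / 2) ρ with hφdef
  set Z : ℝ := ∫ y, φ y ^ 2 with hZ
  set A : ℝ := 2 * radialConst₂ * ∫ z : ℝ, φ (meridianPoint (0, z)) ^ 2 with hA
  set m : ℝ := (∫ y, Ψ y * φ y ^ 2) / Z with hm
  set G : ℝ := ∫ x, ‖gradient Ψ x‖ ^ 2 * φ x ^ 2 with hG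
  set V₁ : ℝ := volume.real (ball (0 : EuclideanSpace ℝ (Fin 3)) 1) with hV₁
  set w : EuclideanSpace ℝ (Fin 3) → ℝ := fun x => 2 / cylRadius x * fderiv ℝ (fun y => φ y ^ 2) x (eR x) with hwdef
  have hρ2 : 0 ≤ ρ / 2 := by positivity
  have hρρ : ρ / 2 < ρ := half_lt_self hρ
  have hV₁0 : 0 < V₁ := by
    rw [hV₁, measureReal_def]
    exact ENNReal.toReal_pos (measure_ball_pos volume _ one_pos).ne' measure_ball_lt_top.ne
  have hZpos : 0 < Z := lt_of_lt_of_le (by positivity) hZlo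
  have hφC : ContDiff ℝ 1 φ := radialCutoff_contDiff _ _
  have hφc : Continuous φ := hφC.continuous
  have hφcs : HasCompactSupport φ := hasCompactSupport_radialCutoff hρ2 hρρ
  have hφa : IsAxisymmetricScalar φ := radialCutoff_axisymmetric _ _
  have hφ0 : ∀ x, 0 ≤ φ x := fun x => radialCutoff_nonneg _ _ _
  have hφK : ∀ x, x ∉ closedBall (0 : EuclideanSpace ℝ (Fin 3)) ρ → φ x = 0 := fun x hx =>
    radialCutoff_eq_zero hρ2 hρρ (le_of_lt (by rwa [mem_closedBall_zero_iff, not_le] at hx))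
  -- the axis weight bound `|w| ≤ Cax φ`
  set Cax : ℝ := 32 * CT / (3 * ρ ^ 2) with hCax
  have hwφ : ∀ x, |w x| ≤ Cax * φ x := by
    intro x
    have h := abs_axis_weight_radialCutoff_sq_le hρ2 hρρ hCT x
    have e : 8 * CT / (ρ ^ 2 - (ρ / 2) ^ 2) = Cax := by rw [hCax]; field_simp; ring
    rw [e] at h
    exact h
  have hCT0 : 0 ≤ CT := (abs_nonneg _).trans (hCT 0)
  have hCax0 : 0 ≤ Cax := by rw [hCax]; positivity
  -- integrability of `w Ψ` (axis lemma with `H = id`) and of `w`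
  have hwΨi : Integrable (fun x => w x * Ψ x) (volume : Measure (EuclideanSpace ℝ (Fin 3))) := by
    obtain ⟨-, hi, -⟩ := integral_axis_term_eq_sub_boundary (F := Ψ) hΨ hΨa (H := fun v => v)
      contDiff_id hφC hφcs hφa
    refine hi.congr (ae_of_all _ fun x => ?_)
    simp only [hwdef]; ring
  have hwmi : Integrable (fun x => w x * (Ψ x - m)) (volume : Measure (EuclideanSpace ℝ (Fin 3))) := by
    have := hwΨi.sub (hwi.mul_const m)
    refine this.congr (ae_of_all _ fun x => ?_)
    simp only [Pi.sub_apply]; ring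
  -- the split `∫ w Ψ = ∫ w (Ψ − m) + m ∫ w`
  have hsplit : ∫ x, w x * Ψ x = (∫ x, w x * (Ψ x - m)) + m * ∫ x, w x := by
    rw [← integral_const_mul, ← integral_add hwmi (hwi.const_mul m)]
    refine integral_congr_ae (ae_of_all _ fun x => ?_)
    ring
  -- Young + Poincaré for the oscillation part
  set δ' : ℝ := δ / (256 * ρ ^ 2) with hδ'
  have hδ'0 : 0 < δ' := by rw [hδ']; positivity
  have hKc : IsCompact (closedBall (0 : EuclideanSpace ℝ (Fin 3)) ρ) := isCompact_closedBall _ _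
  have hpt : ∀ x, |w x * (Ψ x - m)| ≤ δ' * ((Ψ x - m) ^ 2 * φ x ^ 2) +
      Cax ^ 2 / (4 * δ') * (closedBall (0 : EuclideanSpace ℝ (Fin 3)) ρ).indicator (fun _ => (1 : ℝ)) x := by
    intro x
    by_cases hx : x ∈ closedBall (0 : EuclideanSpace ℝ (Fin 3)) ρ
    · rw [indicator_of_mem hx, mul_one, abs_mul]
      have h1 : |w x| * |Ψ x - m| ≤ Cax * φ x * |Ψ x - m| := mul_le_mul_of_nonneg_right (hwφ x) (abs_nonneg _)
      refine h1.trans ?_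
      -- Young: `Cax (φ|Ψ−m|) ≤ δ' (φ|Ψ−m|)² + Cax²/(4δ')`
      have hy : Cax * (φ x * |Ψ x - m|) ≤ δ' * (φ x * |Ψ x - m|) ^ 2 + Cax ^ 2 / (4 * δ') := by
        have hsq := sq_nonneg (2 * δ' * (φ x * |Ψ x - m|) - Cax)
        have e : (2 * δ' * (φ x * |Ψ x - m|) - Cax) ^ 2 =
            4 * δ' * (δ' * (φ x * |Ψ x - m|) ^ 2 + Cax ^ 2 / (4 * δ') - Cax * (φ x * |Ψ x - m|)) := by
          field_simp; ring
        rw [e] at hsq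
        have := (mul_nonneg_iff_of_pos_left (by positivity : (0 : ℝ) < 4 * δ')).1 hsq
        linarith
      calc Cax * φ x * |Ψ x - m| = Cax * (φ x * |Ψ x - m|) := by ring
        _ ≤ δ' * (φ x * |Ψ x - m|) ^ 2 + Cax ^ 2 / (4 * δ') := hy
        _ = δ' * ((Ψ x - m) ^ 2 * φ x ^ 2) + Cax ^ 2 / (4 * δ') := by rw [mul_pow, sq_abs]; ring
    · rw [indicator_of_notMem hx, mul_zero, add_zero]
      have hw0 : w x = 0 := by
        have := hwφ x
        rw [hφK x hx, mul_zero] at this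
        exact abs_eq_zero.1 (le_antisymm this (abs_nonneg _))
      rw [hw0, zero_mul, abs_zero]
      positivity
  have hφ2cs : HasCompactSupport fun x => φ x ^ 2 := hφcs.comp_left (g := fun t : ℝ => t ^ 2) (by simp)
  have hc1 : Continuous fun x => (Ψ x - m) ^ 2 * φ x ^ 2 :=
    ((hΨ.continuous.sub continuous_const).pow 2).mul (hφc.pow 2)
  have hint1 : Integrable (fun x => (Ψ x - m) ^ 2 * φ x ^ 2) (volume : Measure (EuclideanSpace ℝ (Fin 3))) :=
    hc1.integrable_of_hasCompactSupport hφ2cs.mul_left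
  have hint2 : Integrable ((closedBall (0 : EuclideanSpace ℝ (Fin 3)) ρ).indicator fun _ => (1 : ℝ))
      (volume : Measure (EuclideanSpace ℝ (Fin 3))) :=
    (integrable_indicator_iff measurableSet_closedBall).2 (integrableOn_const measure_closedBall_lt_top.ne)
  have hosc : |∫ x, w x * (Ψ x - m)| ≤ δ * G + 64 * ρ ^ 2 / δ * Cax ^ 2 * (ρ ^ 3 * V₁) := by
    have hfin : Module.finrank ℝ (EuclideanSpace ℝ (Fin 3)) = 3 := finrank_euclideanSpace_fin
    have hVK : volume.real (closedBall (0 : EuclideanSpace ℝ (Fin 3)) ρ) = ρ ^ 3 * V₁ := by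
      have h1 := Measure.addHaar_real_closedBall (volume : Measure (EuclideanSpace ℝ (Fin 3)))
        (0 : EuclideanSpace ℝ (Fin 3)) hρ.le
      rwa [hfin] at h1
    calc |∫ x, w x * (Ψ x - m)| ≤ ∫ x, |w x * (Ψ x - m)| := abs_integral_le_integral_abs
      _ ≤ ∫ x, (δ' * ((Ψ x - m) ^ 2 * φ x ^ 2) +
            Cax ^ 2 / (4 * δ') * (closedBall (0 : EuclideanSpace ℝ (Fin 3)) ρ).indicator (fun _ => (1 : ℝ)) x) :=
          integral_mono_of_nonneg (ae_of_all _ fun x => abs_nonneg _)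
            ((hint1.const_mul δ').add (hint2.const_mul _)) (ae_of_all _ hpt)
      _ = δ' * (∫ x, (Ψ x - m) ^ 2 * φ x ^ 2) + Cax ^ 2 / (4 * δ') * volume.real (closedBall (0 : EuclideanSpace ℝ (Fin 3)) ρ) := by
          rw [integral_add (hint1.const_mul δ') (hint2.const_mul _), MeasureTheory.integral_const_mul,
            MeasureTheory.integral_const_mul, integral_indicator measurableSet_closedBall, setIntegral_const,
            smul_eq_mul, mul_one]
      _ ≤ δ' * (256 * ρ ^ 2 * G) + Cax ^ 2 / (4 * δ') * (ρ ^ 3 * V₁) := by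
          rw [hVK]
          exact add_le_add (mul_le_mul_of_nonneg_left hP hδ'0.le) le_rfl
      _ = δ * G + 64 * ρ ^ 2 / δ * Cax ^ 2 * (ρ ^ 3 * V₁) := by
          rw [hδ']; field_simp; ring
  -- assemble
  have hmw : m * ∫ x, w x = -(A / Z * ∫ x, Ψ x * φ x ^ 2) := by
    rw [hw, hm]; field_simp
  have hlhs : ∫ x, 2 / cylRadius x * (Ψ x * fderiv ℝ (fun y => φ y ^ 2) x (eR x)) = ∫ x, w x * Ψ x :=
    integral_congr_ae (ae_of_all _ fun x => by simp only [hwdef]; ring)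
  rw [hlhs, hsplit, hmw]
  have := (le_abs_self _).trans hosc
  linarith


/-! ### Nash's inequality combined with the weighted Poincaré inequality -/

/-- **The Nash–Poincaré lower bound for the good term** (Lei–Zhang 2011, proof of Lemma 3.2,
p. 10: "`|ln∫Φ̃ζ² + ∫Ψζ²|²(∫Φ̃ζ²)² ≤ M²∫|−Ψ + ∫Ψζ²|²ζ² ≤ C∫|∇Ψ|²ζ²`" and its use on the set `W`).
For `ρ, ε > 0`, `φ = radialCutoff (ρ/2) ρ`, `Z = ∫φ²`, a slice `F ∈ C¹` with `ε ≤ F ≤ 3` on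
`B̄(0,ρ)`, `H ∈ C¹` with `H = −log` on `[ε/2, ∞)`, and numbers `w₀ > 0`, `L₀ ≥ max(0, −ln w₀)`:
if `∫ F φ² ≥ w₀ Z` and `Y = ∫ H(F) φ² ≥ 2 L₀ Z`, then
`w₀² Y² / (9216 ρ² Z) ≤ ∫ H'(F)² ‖∇F‖² φ²` (Nash's inequality `abs_log_integral_sub_integral_log_le`
for the probability measure `φ²dx/Z`, `f = F` clamped to `[ε, 3]`, `M = 3`, then the weighted
Poincaré inequality for `Ψ = H∘F`; `ln(∫Fφ²/Z) + Y/Z ≥ Y/(2Z) ≥ 0`). [cite: LeiZhang2011, proof of Lemma 3.2 (arXiv p. 10), Nash inequality step] -/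
theorem nash_poincare_lower {ρ ε : ℝ} (hρ : 0 < ρ) (hε : 0 < ε)
    {F : EuclideanSpace ℝ (Fin 3) → ℝ} (hF : ContDiff ℝ 1 F)
    (hFb : ∀ x ∈ closedBall (0 : EuclideanSpace ℝ (Fin 3)) ρ, ε ≤ F x ∧ F x ≤ 3)
    {H : ℝ → ℝ} (hH : ContDiff ℝ 1 H) (hHeq : ∀ v, ε / 2 ≤ v → H v = -Real.log v)
    {w₀ L₀ : ℝ} (hw₀ : 0 < w₀) (hL₀0 : 0 ≤ L₀) (hL₀ : -Real.log w₀ ≤ L₀)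
    (hmass : w₀ * ∫ y : EuclideanSpace ℝ (Fin 3), radialCutoff (ρ / 2) ρ y ^ 2 ≤
      ∫ x, F x * radialCutoff (ρ / 2) ρ x ^ 2)
    (hY : 2 * L₀ * ∫ y : EuclideanSpace ℝ (Fin 3), radialCutoff (ρ / 2) ρ y ^ 2 ≤
      ∫ x, H (F x) * radialCutoff (ρ / 2) ρ x ^ 2) :
    w₀ ^ 2 / (9216 * ρ ^ 2 * ∫ y : EuclideanSpace ℝ (Fin 3), radialCutoff (ρ / 2) ρ y ^ 2) *
        (∫ x, H (F x) * radialCutoff (ρ / 2) ρ x ^ 2) ^ 2 ≤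
      ∫ x, deriv H (F x) ^ 2 * ‖gradient F x‖ ^ 2 * radialCutoff (ρ / 2) ρ x ^ 2 := by
  obtain ⟨hZlo, -⟩ := radialCutoff_sq_mass hρ
  have hP := integral_sub_average_sq_mul_radialCutoff_sq_le hρ (hH.comp hF)
  set φ : EuclideanSpace ℝ (Fin 3) → ℝ := radialCutoff (ρ / 2) ρ with hφdef
  set Z : ℝ := ∫ y, φ y ^ 2 with hZ
  set Y : ℝ := ∫ x, H (F x) * φ x ^ 2 with hYdef
  set G : ℝ := ∫ x, deriv H (F x) ^ 2 * ‖gradient F x‖ ^ 2 * φ x ^ 2 with hG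
  have hρ2 : 0 ≤ ρ / 2 := by positivity
  have hρρ : ρ / 2 < ρ := half_lt_self hρ
  have hV₁0 : 0 < volume.real (ball (0 : EuclideanSpace ℝ (Fin 3)) 1) := by
    rw [measureReal_def]
    exact ENNReal.toReal_pos (measure_ball_pos volume _ one_pos).ne' measure_ball_lt_top.ne
  have hZpos : 0 < Z := lt_of_lt_of_le (by positivity) hZlo
  have hφc : Continuous φ := (radialCutoff_contDiff (ρ / 2) ρ (n := 0)).continuous
  have hφ0 : ∀ x, 0 ≤ φ x := fun x => radialCutoff_nonneg _ _ _
  have hφK : ∀ x, x ∉ closedBall (0 : EuclideanSpace ℝ (Fin 3)) ρ → φ x = 0 := fun x hx =>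
    radialCutoff_eq_zero hρ2 hρρ (le_of_lt (by rwa [mem_closedBall_zero_iff, not_le] at hx))
  -- the weighted mean of `Ψ = H∘F` is `Y/Z`; Poincaré in terms of `G`
  set m : ℝ := Y / Z with hm
  have hgradΨ : ∀ x, ‖gradient (H ∘ F) x‖ ^ 2 = deriv H (F x) ^ 2 * ‖gradient F x‖ ^ 2 := by
    intro x
    have h := gradient_comp_apply ((hH.differentiable one_ne_zero) (F x)) ((hF.differentiable one_ne_zero) x)
    rw [show (H ∘ F) = fun y => H (F y) from rfl, h, norm_smul, mul_pow, Real.norm_eq_abs, sq_abs]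
  have hPG : ∫ x, (H (F x) - m) ^ 2 * φ x ^ 2 ≤ 256 * ρ ^ 2 * G := by
    have e1 : (∫ y, (H ∘ F) y * φ y ^ 2) / Z = m := by rw [hm, hYdef]; rfl
    have e2 : ∫ x, ‖gradient (H ∘ F) x‖ ^ 2 * φ x ^ 2 = G := by
      rw [hG]
      refine integral_congr_ae (ae_of_all _ fun x => ?_)
      dsimp only
      rw [hgradΨ x]
    rw [e1, e2] at hP
    exact hP
  -- the clamped slice `f = max ε (min F 3)`: `0 < f ≤ 3`, `f = F` where `φ ≠ 0`
  have hε3 : ε ≤ 3 := by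
    have h := hFb 0 (mem_closedBall_self hρ.le)
    exact h.1.trans h.2
  set f : EuclideanSpace ℝ (Fin 3) → ℝ := fun x => max ε (min (F x) 3) with hfdef
  have hf0 : ∀ x, 0 < f x := fun x => hε.trans_le (le_max_left _ _)
  have hfε : ∀ x, ε ≤ f x := fun x => le_max_left _ _
  have hf3 : ∀ x, f x ≤ 3 := fun x => max_le hε3 (min_le_right _ _)
  have hfF : ∀ x, φ x ≠ 0 → f x = F x := by
    intro x hx
    have hxK : x ∈ closedBall (0 : EuclideanSpace ℝ (Fin 3)) ρ := by
      by_contra h; exact hx (hφK x h)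
    obtain ⟨h1, h2⟩ := hFb x hxK
    simp only [hfdef, min_eq_left h2, max_eq_right h1]
  have hfc : Continuous f := continuous_const.max (hF.continuous.min continuous_const)
  have hlogc : Continuous fun x => Real.log (f x) := hfc.log fun x => (hf0 x).ne'
  -- pointwise identities against `φ²`
  have hfφ : ∀ x, φ x ^ 2 * f x = F x * φ x ^ 2 := by
    intro x
    by_cases hx : φ x = 0
    · rw [hx]; ring
    · rw [hfF x hx]; ring
  have hlogφ : ∀ x, φ x ^ 2 * Real.log (f x) = -(H (F x) * φ x ^ 2) := by
    intro x
    by_cases hx : φ x = 0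
    · rw [hx]; ring
    · have hxK : x ∈ closedBall (0 : EuclideanSpace ℝ (Fin 3)) ρ := by
        by_contra h; exact hx (hφK x h)
      have hv : ε / 2 ≤ F x := (half_le_self hε.le).trans (hFb x hxK).1
      rw [hfF x hx, hHeq _ hv]; ring
  -- the probability measure `φ² dx / Z`
  set ω : EuclideanSpace ℝ (Fin 3) → ℝ≥0∞ := fun x => ENNReal.ofReal (φ x ^ 2) with hωdef
  have hωm : Measurable ω := ENNReal.measurable_ofReal.comp (hφc.pow 2).measurable
  have hωtop : ∀ᵐ x ∂(volume : Measure (EuclideanSpace ℝ (Fin 3))), ω x < ∞ :=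
    ae_of_all _ fun x => ENNReal.ofReal_lt_top
  have hωtoReal : ∀ x, (ω x).toReal = φ x ^ 2 := fun x => ENNReal.toReal_ofReal (sq_nonneg _)
  have hφcs : HasCompactSupport φ := hasCompactSupport_radialCutoff hρ2 hρρ
  have hφ2cs : HasCompactSupport fun x => φ x ^ 2 := hφcs.comp_left (g := fun t : ℝ => t ^ 2) (by simp)
  have hφ2c : Continuous fun x => φ x ^ 2 := hφc.pow 2
  have hφ2i : Integrable (fun x => φ x ^ 2) (volume : Measure (EuclideanSpace ℝ (Fin 3))) :=
    hφ2c.integrable_of_hasCompactSupport hφ2cs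
  have hlintω : ∫⁻ x, ω x = ENNReal.ofReal Z := by
    rw [hZ, ofReal_integral_eq_lintegral_ofReal hφ2i (ae_of_all _ fun x => sq_nonneg _)]
  set ν : Measure (EuclideanSpace ℝ (Fin 3)) := volume.withDensity ω with hν
  have hνuniv : ν univ = ENNReal.ofReal Z := by
    rw [hν, withDensity_apply _ MeasurableSet.univ, Measure.restrict_univ, hlintω]
  have hZne : ENNReal.ofReal Z ≠ 0 := (ENNReal.ofReal_pos.2 hZpos).ne'
  set μ : Measure (EuclideanSpace ℝ (Fin 3)) := (ENNReal.ofReal Z)⁻¹ • ν with hμ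
  haveI hprob : IsProbabilityMeasure μ := ⟨by
    rw [hμ, Measure.smul_apply, hνuniv, smul_eq_mul, ENNReal.inv_mul_cancel hZne ENNReal.ofReal_ne_top]⟩
  have hμint : ∀ g : EuclideanSpace ℝ (Fin 3) → ℝ, ∫ x, g x ∂μ = Z⁻¹ * ∫ x, φ x ^ 2 * g x := by
    intro g
    rw [hμ, integral_smul_measure, hν, integral_withDensity_eq_integral_toReal_smul hωm hωtop,
      ENNReal.toReal_inv, ENNReal.toReal_ofReal hZpos.le, smul_eq_mul]
    congr 1
    refine integral_congr_ae (ae_of_all _ fun x => ?_)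
    dsimp only
    rw [hωtoReal x, smul_eq_mul]
  -- the three integrals of Nash's inequality
  have hq : ∫ x, f x ∂μ = Z⁻¹ * ∫ x, F x * φ x ^ 2 := by
    rw [hμint]; congr 1
    exact integral_congr_ae (ae_of_all _ fun x => hfφ x)
  have hlogint : ∫ x, Real.log (f x) ∂μ = -(Y / Z) := by
    rw [hμint, integral_congr_ae (ae_of_all _ fun x => hlogφ x), integral_neg, hYdef]
    field_simp
  have hvar : ∫ x, (Real.log (f x) - ∫ y, Real.log (f y) ∂μ) ^ 2 ∂μ = Z⁻¹ * ∫ x, (H (F x) - m) ^ 2 * φ x ^ 2 := by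
    rw [hlogint, hμint]
    congr 1
    refine integral_congr_ae (ae_of_all _ fun x => ?_)
    dsimp only
    by_cases hx : φ x = 0
    · simp only [hx]; ring
    · have hxK : x ∈ closedBall (0 : EuclideanSpace ℝ (Fin 3)) ρ := by
        by_contra h; exact hx (hφK x h)
      have hv : ε / 2 ≤ F x := (half_le_self hε.le).trans (hFb x hxK).1
      rw [hfF x hx, hHeq _ hv, hm]
      ring
  -- Nash's inequality
  have hlogm : MemLp (fun x => Real.log (f x)) 2 μ := by
    refine (memLp_top_of_bound hlogc.aestronglyMeasurable (max |Real.log ε| |Real.log 3|)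
      (ae_of_all _ fun x => ?_)).mono_exponent le_top
    rw [Real.norm_eq_abs, abs_le]
    constructor
    · have h1 : Real.log ε ≤ Real.log (f x) := Real.log_le_log hε (hfε x)
      have h2 : -max |Real.log ε| |Real.log 3| ≤ Real.log ε :=
        (neg_le_neg (le_max_left _ _)).trans (neg_abs_le _)
      linarith
    · have h1 : Real.log (f x) ≤ Real.log 3 := Real.log_le_log (hf0 x) (hf3 x)
      exact h1.trans ((le_abs_self _).trans (le_max_right _ _))
  have hN := abs_log_integral_sub_integral_log_le (μ := μ) hf0 hf3 hlogm
  rw [hvar, hlogint, hq] at hN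
  -- the numbers
  set q : ℝ := Z⁻¹ * ∫ x, F x * φ x ^ 2 with hqdef
  have hqw : w₀ ≤ q := by
    rw [hqdef, inv_mul_eq_div, le_div_iff₀ hZpos]; exact hmass
  have hqpos : 0 < q := hw₀.trans_le hqw
  have hYZ : 2 * L₀ ≤ Y / Z := by rw [le_div_iff₀ hZpos]; exact hY
  have hY0 : 0 ≤ Y / (2 * Z) := by
    have : 0 ≤ Y / Z := le_trans (by positivity) hYZ
    rw [div_nonneg_iff]; left
    exact ⟨by have := this; rwa [le_div_iff₀ hZpos, zero_mul] at this, by positivity⟩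
  have hlogq : -L₀ ≤ Real.log q := by
    have := Real.log_le_log hw₀ hqw
    linarith
  have hkey : Y / (2 * Z) ≤ |Real.log q - -(Y / Z)| := by
    refine le_trans ?_ (le_abs_self _)
    have e : Y / (2 * Z) = Y / Z - Y / (2 * Z) := by field_simp; ring
    rw [sub_neg_eq_add]
    have : Y / (2 * Z) ≤ Y / Z - L₀ := by
      rw [e]
      have h2 : L₀ ≤ Y / (2 * Z) := by
        rw [le_div_iff₀ (by positivity)]; nlinarith [hYZ, hZpos]
      linarith
    linarith
  have hG0 : 0 ≤ G := integral_nonneg fun x => by positivity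
  -- `(Y/(2Z)) q ≤ 3 √(Z⁻¹ · 256ρ² G)`
  have h1 : Y / (2 * Z) * q ≤ 3 * Real.sqrt (Z⁻¹ * (256 * ρ ^ 2 * G)) := by
    have h := hkey.trans hN
    rw [le_div_iff₀ hqpos] at h
    refine h.trans (mul_le_mul_of_nonneg_left (Real.sqrt_le_sqrt ?_) (by norm_num))
    exact mul_le_mul_of_nonneg_left hPG (inv_nonneg.2 hZpos.le)
  have h2 : Y / (2 * Z) * w₀ ≤ 3 * Real.sqrt (Z⁻¹ * (256 * ρ ^ 2 * G)) :=
    (mul_le_mul_of_nonneg_left hqw hY0).trans h1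
  -- square
  have h3 : (Y / (2 * Z) * w₀) ^ 2 ≤ 9 * (Z⁻¹ * (256 * ρ ^ 2 * G)) := by
    have hl : 0 ≤ Y / (2 * Z) * w₀ := mul_nonneg hY0 hw₀.le
    have := pow_le_pow_left₀ hl h2 2
    rw [mul_pow (3 : ℝ), Real.sq_sqrt (by positivity)] at this
    linarith [this]
  -- rearrange
  have e : w₀ ^ 2 / (9216 * ρ ^ 2 * Z) * Y ^ 2 = (Z / (2304 * ρ ^ 2)) * (Y / (2 * Z) * w₀) ^ 2 := by
    field_simp
    ring
  rw [e]
  calc Z / (2304 * ρ ^ 2) * (Y / (2 * Z) * w₀) ^ 2 ≤ Z / (2304 * ρ ^ 2) * (9 * (Z⁻¹ * (256 * ρ ^ 2 * G))) :=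
        mul_le_mul_of_nonneg_left h3 (by positivity)
    _ = G := by field_simp; ring

end LeiZhang2011

end Literature.Analysis.FluidPDE
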